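import Summits.QuantumFields.YangMills.Theses.ComplexCouplingChannel
import Literature.MathematicalPhysics.QuantumFieldTheory.WilsonFinTorusPartitionComplex
import Literature.Barriers.QuantumFields.DiscreteSubgroupFreezing
import HarnessLib

/-!
# `ComplexCouplingChannel.FreeEnergyWindowChannel` — negative lemma: rigidity of every window
witness (refuter / cdisprove, crux stmt-QuantumFields-18842)

The crux `Summit.QuantumFields.YangMills.Theses.ComplexCouplingChannel.FreeEnergyWindowChannel`
asks, for every compact simple Lie `G`, faithful unitary `r` and all large `β`, for a channel
`D ∋ β` and WINDOW DATA `(f, M, P₀)` on it: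

  `∀ P ≥ P₀, ∀ z ∈ D, Z(z;P⁴) ≠ 0 ∧ |log ‖Z(z;P⁴)‖ + P⁴ Re f(z)| ≤ M`,

`Z(z;P⁴) = wilsonFinTorusPartitionC r.ρ z P P P P` (the item's inline `Zc` by `rfl`,
`wilsonFinTorusPartitionC_eq_inline`).  This file proves the NECESSARY CONDITIONS that every such
witness satisfies — constraints a prover's `f` must meet and a disprover may try to violate — all
consequences of positivity of the Wilson action (`Re tr ρ(U) ≤ N` for unitary `ρ`) and of the
modulus bound `‖Z(z)‖ ≤ Z(Re z)` (`norm_wilsonFinTorusPartitionC_le`):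

* `wilsonFinTorusPartition_le_one`, `norm_wilsonFinTorusPartitionC_le_one` — `0 < Z(β) ≤ 1` for
  `β ≥ 0` and `‖Z(z)‖ ≤ 1` on the closed right half-plane;
* `neg_le_log_partition_re_add` — window data force, for all `P ≥ P₀` and `z ∈ D`,
  `-M ≤ log Z(Re z; P⁴) + P⁴ Re f(z)`: the continued free energy at `z` is bounded BELOW by the
  physical finite-volume free energy at the real coupling `Re z`, up to `M/P⁴`;
* `re_nonneg_of_window` — hence `Re f ≥ 0` on `D ∩ {0 ≤ Re z}`;
* `re_apply_re_le_re_of_window` — and whenever both `z` and `Re z` lie in `D`,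
  `Re f(Re z) ≤ Re f(z)`: on every vertical fibre of the channel the real part of the continued
  bulk free energy is MINIMAL on the real axis (the finite-`P` shadow of `‖Z(z)‖ ≤ Z(Re z)`; it is
  the global form of the concavity `f'' = -χ ≤ 0` of the real free energy).  E.g. no witness can
  have `f` locally of the form `c + (z - β)²` near a real `β ∈ D`.

Nothing here asserts a Theses statement; the lemmas support the crux item (they quantify over
arbitrary window data, which is what the crux's `∃ f M P₀` produces).  Hypothesis used from the
interface: `r.mem_unitary` (action non-negative) and `r.continuous`, `r.injective` (second
countability of `G` for `Z(β) > 0`).  No use of simplicity.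
-/

set_option autoImplicit false

noncomputable section

open scoped Topology
open MeasureTheory Filter Set Metric
open Literature.MathematicalPhysics.QuantumFieldTheory

namespace Summit.QuantumFields.YangMills.Theorems.FreeEnergyWindowChannel.Negative

variable {G : Type*} [Group G] [TopologicalSpace G] [IsTopologicalGroup G] [CompactSpace G]
  [MeasurableSpace G] [BorelSpace G]

omit [MeasurableSpace G] [BorelSpace G] [IsTopologicalGroup G] [CompactSpace G] in
/-- The Wilson action of the `Fin`-torus is non-negative for a unitary representation
(`Re tr ρ(U) ≤ N`). [folklore] -/
theorem finTorusWilsonAction_nonneg (r : LatticeRep G) {n₀ n₁ n₂ n₃ : ℕ}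
    (U : FinTorusSite n₀ n₁ n₂ n₃ × Fin 4 → G) : 0 ≤ finTorusWilsonAction r.ρ U :=
  Finset.sum_nonneg fun _ _ => Finset.sum_nonneg fun _ _ =>
    sub_nonneg.2 (Literature.Barriers.QuantumFields.re_trace_le_of_mem_unitaryGroup (r.mem_unitary _))

/-- **`Z(β) ≤ 1` for `β ≥ 0`**: the real Wilson partition function of the `Fin`-torus is the
integral of `e^{-β S} ≤ 1` (`S ≥ 0`) against a probability measure. [folklore] -/
theorem wilsonFinTorusPartition_le_one (r : LatticeRep G) {β : ℝ} (hβ : 0 ≤ β) (n₀ n₁ n₂ n₃ : ℕ) :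
    wilsonFinTorusPartition r.ρ β n₀ n₁ n₂ n₃ ≤ 1 := by
  unfold wilsonFinTorusPartition
  have key : ∀ g : (FinTorusSite n₀ n₁ n₂ n₃ × Fin 4 → G) → ℝ, (∀ U, g U ≤ 1) →
      ∫ U, g U ∂(Measure.pi fun _ : FinTorusSite n₀ n₁ n₂ n₃ × Fin 4 => haarProbability G) ≤ 1 := by
    intro g hg
    by_cases hint : Integrable g (Measure.pi fun _ : FinTorusSite n₀ n₁ n₂ n₃ × Fin 4 => haarProbability G)
    · calc ∫ U, g U ∂(Measure.pi fun _ : FinTorusSite n₀ n₁ n₂ n₃ × Fin 4 => haarProbability G)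
          ≤ ∫ _U, (1 : ℝ) ∂(Measure.pi fun _ : FinTorusSite n₀ n₁ n₂ n₃ × Fin 4 => haarProbability G) :=
            integral_mono hint (integrable_const 1) hg
        _ = 1 := by simp
    · rw [integral_undef hint]; exact zero_le_one
  refine key _ fun U => Real.exp_le_one_iff.2 ?_
  have hS : 0 ≤ ∑ x : FinTorusSite n₀ n₁ n₂ n₃, ∑ q : {q : Fin 4 × Fin 4 // q.1 < q.2},
      ((r.N : ℝ) - (r.ρ (finTorusPlaquette U x q.1.1 q.1.2)).trace.re) :=
    finTorusWilsonAction_nonneg r U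
  exact mul_nonpos_of_nonpos_of_nonneg (neg_nonpos.2 hβ) hS

/-- **`‖Z(z)‖ ≤ 1` on the closed right half-plane** (`‖Z(z)‖ ≤ Z(Re z) ≤ 1`). [folklore] -/
theorem norm_wilsonFinTorusPartitionC_le_one (r : LatticeRep G) {z : ℂ} (hz : 0 ≤ z.re)
    (n₀ n₁ n₂ n₃ : ℕ) : ‖wilsonFinTorusPartitionC r.ρ z n₀ n₁ n₂ n₃‖ ≤ 1 :=
  (norm_wilsonFinTorusPartitionC_le r.ρ z n₀ n₁ n₂ n₃).trans (wilsonFinTorusPartition_le_one r hz _ _ _ _)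

/-- Archimedean step: if `P⁴ a ≤ K` for all large naturals `P`, then `a ≤ 0`. [folklore] -/
theorem nonpos_of_forall_pow_four_mul_le {a K : ℝ} {P₀ : ℕ}
    (h : ∀ P : ℕ, P₀ ≤ P → (P : ℝ) ^ 4 * a ≤ K) : a ≤ 0 := by
  by_contra ha
  have hpos : 0 < a := lt_of_not_ge ha
  obtain ⟨P, hP⟩ := exists_nat_gt (max (P₀ : ℝ) (K / a))
  have hP₀' : (P₀ : ℝ) < P := (le_max_left _ _).trans_lt hP
  have hP₀ : P₀ ≤ P := by exact_mod_cast hP₀'.le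
  have hPK : K / a < P := (le_max_right _ _).trans_lt hP
  have hP1 : (1 : ℝ) ≤ P := by
    have h0 : (0 : ℝ) < P := (Nat.cast_nonneg P₀).trans_lt hP₀'
    exact_mod_cast Nat.one_le_iff_ne_zero.2 (by rintro rfl; simp at h0)
  have hP4 : (P : ℝ) ≤ (P : ℝ) ^ 4 := le_self_pow₀ hP1 (by norm_num)
  have h3 : K < (P : ℝ) * a := by rwa [div_lt_iff₀ hpos] at hPK
  have h4 := h P hP₀
  nlinarith [mul_le_mul_of_nonneg_right hP4 hpos.le]

/-- **Lower rigidity of the continued free energy.**  Window data `(f, M, P₀)` on `D` force, for all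
`P ≥ P₀` and `z ∈ D`, `-M ≤ log Z(Re z; P⁴) + P⁴ Re f(z)` — because
`-M ≤ log ‖Z(z;P⁴)‖ + P⁴ Re f(z)` and `‖Z(z)‖ ≤ Z(Re z)`.  In the limit: `Re f(z) ≥ f_phys(Re z)`,
the continued branch is never super-dominant with respect to the physical free energy at the same
real part of the coupling. [folklore] -/
theorem neg_le_log_partition_re_add (r : LatticeRep G) {D : Set ℂ} {f : ℂ → ℂ} {M : ℝ} {P₀ : ℕ}
    (h : ∀ P : ℕ, P₀ ≤ P → ∀ z ∈ D, wilsonFinTorusPartitionC r.ρ z P P P P ≠ 0 ∧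
      |Real.log ‖wilsonFinTorusPartitionC r.ρ z P P P P‖ + (P : ℝ) ^ 4 * (f z).re| ≤ M)
    {P : ℕ} (hP : P₀ ≤ P) {z : ℂ} (hz : z ∈ D) :
    -M ≤ Real.log (wilsonFinTorusPartition r.ρ z.re P P P P) + (P : ℝ) ^ 4 * (f z).re := by
  obtain ⟨hne, hb⟩ := h P hP z hz
  have h1 := (abs_le.1 hb).1
  have hlog : Real.log ‖wilsonFinTorusPartitionC r.ρ z P P P P‖ ≤
      Real.log (wilsonFinTorusPartition r.ρ z.re P P P P) :=
    Real.log_le_log (norm_pos_iff.2 hne) (norm_wilsonFinTorusPartitionC_le r.ρ z P P P P)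
  linarith

/-- **`Re f ≥ 0` on the right half-plane part of the channel.**  Window data on `D` force
`0 ≤ Re f(z)` at every `z ∈ D` with `0 ≤ Re z` (`log Z(Re z;P⁴) ≤ 0` there, so `P⁴ Re f(z) ≥ -M`
for all large `P`). [folklore] -/
theorem re_nonneg_of_window (r : LatticeRep G) {D : Set ℂ} {f : ℂ → ℂ} {M : ℝ} {P₀ : ℕ}
    (h : ∀ P : ℕ, P₀ ≤ P → ∀ z ∈ D, wilsonFinTorusPartitionC r.ρ z P P P P ≠ 0 ∧
      |Real.log ‖wilsonFinTorusPartitionC r.ρ z P P P P‖ + (P : ℝ) ^ 4 * (f z).re| ≤ M)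
    {z : ℂ} (hz : z ∈ D) (hz0 : 0 ≤ z.re) : 0 ≤ (f z).re := by
  have key : ∀ P : ℕ, P₀ ≤ P → (P : ℝ) ^ 4 * (-(f z).re) ≤ M := fun P hP => by
    have h1 := neg_le_log_partition_re_add r h hP hz
    have hlog : Real.log (wilsonFinTorusPartition r.ρ z.re P P P P) ≤ 0 :=
      Real.log_nonpos ((norm_nonneg _).trans (norm_wilsonFinTorusPartitionC_le r.ρ z P P P P))
        (wilsonFinTorusPartition_le_one r hz0 _ _ _ _)
    linarith
  have := nonpos_of_forall_pow_four_mul_le key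
  linarith

/-- **Vertical-fibre minimality.**  If window data hold on `D` and both `z` and its real part
`Re z` lie in `D`, then `Re f(Re z) ≤ Re f(z)`: on each vertical fibre of the channel the real part
of the continued bulk free energy is minimal on the real axis.  (At the real point the window reads
`|log Z(Re z;P⁴) + P⁴ Re f(Re z)| ≤ M` with `Z(Re z) > 0`; subtract `neg_le_log_partition_re_add`.)
[folklore] -/
theorem re_apply_re_le_re_of_window (r : LatticeRep G) {D : Set ℂ} {f : ℂ → ℂ} {M : ℝ} {P₀ : ℕ}
    (h : ∀ P : ℕ, P₀ ≤ P → ∀ z ∈ D, wilsonFinTorusPartitionC r.ρ z P P P P ≠ 0 ∧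
      |Real.log ‖wilsonFinTorusPartitionC r.ρ z P P P P‖ + (P : ℝ) ^ 4 * (f z).re| ≤ M)
    {z : ℂ} (hz : z ∈ D) (hzr : ((z.re : ℝ) : ℂ) ∈ D) :
    (f (z.re : ℂ)).re ≤ (f z).re := by
  haveI : SecondCountableTopology G :=
    (r.continuous.isClosedEmbedding r.injective).isEmbedding.secondCountableTopology
  have key : ∀ P : ℕ, P₀ ≤ P → (P : ℝ) ^ 4 * ((f (z.re : ℂ)).re - (f z).re) ≤ 2 * M := fun P hP => by
    have h1 := neg_le_log_partition_re_add r h hP hz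
    obtain ⟨-, hb⟩ := h P hP _ hzr
    have h2 := (abs_le.1 hb).2
    have hnorm : ‖wilsonFinTorusPartitionC r.ρ ((z.re : ℝ) : ℂ) P P P P‖ =
        wilsonFinTorusPartition r.ρ z.re P P P P := by
      rw [wilsonFinTorusPartitionC_ofReal, Complex.norm_real, Real.norm_eq_abs,
        abs_of_pos (wilsonFinTorusPartition_pos r.continuous z.re P P P P)]
    rw [hnorm] at h2
    linarith
  have := nonpos_of_forall_pow_four_mul_le key
  linarith

end Summit.QuantumFields.YangMills.Theorems.FreeEnergyWindowChannel.Negative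

end
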